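import Summits.RiemannHypothesis.RiemannHypothesis.Theorems.Splittings.LiIncrHighPart
import HarnessLib

/-!
# The INCREMENT ENVELOPE LAW for the Keiper–Li coefficients — window file (SketchG11 §§1–2; RH-free except the two `highPart` transfers)

Cell rh-split, seat rh-split-li-bridge g11 (brief sha16 f79c5f09d8bcb036), card `run/shared/lean/pub/rh-split/cards/SPLIT-li-bridge.md` §18;
kernel source `HOME/rh-split-li-bridge/SketchG11.lean` sha16 f517e835010cd3f4 (726 l, farm rc 0 · 0 err · 0 warn · 0 sorry, std axioms), cut by
the seat at the scratch's section boundaries (§§1–2 / §3 / §4), decl text byte-verbatim; deltas = namespace `RhSplit.LiBridgeG11` ↦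
`…Theorems.Splittings.LiIncrEnvelope`, imports, module docstrings, `open` lists trimmed to the imported namespaces.

Write `λ_n = keiperLiCoeff n`, `Δ_n = liIncr n = λ_{n+1} − λ_n`, and split `Δ_n = lowSum n Y + highPart n Y` at a height cut `Y` as in the
tree's `LiIncrHighPartSplit`.  This file supplies the two RH-free inputs of the envelope law and the upper transfer:
* `abs_lowSum_le` (RH-FREE): `|lowSum n Y| ≤ 12·L(1+L)`, `L = log(⌈Y⌉₊ + 2)` — every model term has modulus `≤ 2m/γ` and the tree's
  `LiLowZeroBudget.recip_le` gives `Σ_{0<γ≤Y} m/γ ≤ 6L(1+L)`;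
* `model_main_upper`, `liMainTerm_succ_sub_le`, `liC1_le`, `window_rhs_upper` (RH-FREE): the UPPER mirrors of the tree's one-sided chain
  `LiIncrHighPartModelB.model_main_lower` / `LiIncrHighPart.window_rhs_lower` (same two-sided error terms `abs_integral_thetaErr_le`,
  `abs_integral_modelErr_le`, `abs_S_mul_incrWeight_le`, `abs_integral_S_mul_incrWeightDeriv_le`, `head_small`, `abs_tail_le'`,
  `integral_one_sub_cos_tail_bounds`, `abs_integral_gK_local_le`, `tail_small`, read from above), giving for `1 ≤ n`, `30 ≤ Y`,
  `4Y(log(n+1)+2) ≤ n`: `RHS(T') ≤ ½ log n + n(0.34 log Y + 3.5)/Y² + 8` for all large `T'`;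
* `highPart_le_of_eventually`, `highPart_upper` (RH ⟹): `highPart n Y ≤ ½ log n + n(0.34 log Y + 3.5)/Y² + 8`, the mirror of the tree's
  `highPart_lower`.
Zero definitions; standard axioms.

HONEST LABEL: «SPLITTING SEARCH over kernel-typed RH-EQUIVALENCES; a splitting A ∧ B ⟹ RH is CONDITIONAL bookkeeping unless A and B are
both proved; nothing here bears on the truth of RH.»  Every theorem below is RH-FREE or an RH-CONSEQUENCE (`RiemannHypothesis → …`); none is a claim about RH.
-/

set_option linter.dupNamespace false

noncomputable section

namespace Summit.RiemannHypothesis.RiemannHypothesis.Theorems.Splittings.LiIncrEnvelope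

open Filter Topology Finset Set MeasureTheory Asymptotics
open scoped Real
open Literature.NumberTheory.LFunctions Literature.NumberTheory.LFunctions.SchoenfeldBound
open Literature.NumberTheory.DiophantineGeometry
open Summit.RiemannHypothesis.RiemannHypothesis.Theorems.LiTheory
open Summit.RiemannHypothesis.RiemannHypothesis.Theorems.LiTheory.SmoothReplace
open Summit.RiemannHypothesis.RiemannHypothesis.Theorems.LiTheory.Window
open Summit.RiemannHypothesis.RiemannHypothesis.Theorems.Splittings
open Summit.RiemannHypothesis.RiemannHypothesis.Theorems.Splittings.LiIncrHighPart

/-! ## §1 The low-zero part is `O(log² Y)` pointwise (RH-free) -/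

/-- **RH-free.** `|lowSum n Y| ≤ 2 Σ_{0<γ≤Y} m/γ ≤ 12 L (1 + L)`, `L = log(⌈Y⌉₊ + 2)`
(`|4 m sin(θ_γ/2) sin((n+½)θ_γ)| ≤ m·2/γ` by the tree's `LiLowZeroBudget.amp_bounds`, then `LiLowZeroBudget.recip_le`). -/
theorem abs_lowSum_le (n : ℕ) (Y : ℝ) :
    |lowSum n Y| ≤ 12 * Real.log ((⌈Y⌉₊ : ℝ) + 2) * (1 + Real.log ((⌈Y⌉₊ : ℝ) + 2)) := by
  have hrec := LiLowZeroBudget.recip_le Y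
  have hterm : ∀ ρ ∈ zerosBetween 0 Y,
      |mult ρ * (4 * Real.sin (liZeroAngle ρ.im / 2)) *
          Real.sin (((n : ℝ) + 1 / 2) * liZeroAngle ρ.im)| ≤
        2 * (LiLowZeroBudget.mult ρ / ρ.im) := by
    intro ρ hρ
    have h14 := LiLowZeroBudget.fourteen_lt_im hρ
    have hγ0 : 0 < ρ.im := by linarith
    obtain ⟨ha0, ha1⟩ := LiLowZeroBudget.amp_bounds h14
    have hm0 : 0 ≤ LiLowZeroBudget.mult ρ := LiLowZeroBudget.mult_nonneg le_rfl hρ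
    have hmm : mult ρ = LiLowZeroBudget.mult ρ := rfl
    simp only [LiLowZeroBudget.amp] at ha0 ha1
    rw [hmm, abs_mul, abs_mul, abs_of_nonneg hm0, abs_of_nonneg ha0]
    have hs : |Real.sin (((n : ℝ) + 1 / 2) * liZeroAngle ρ.im)| ≤ 1 := Real.abs_sin_le_one _
    calc LiLowZeroBudget.mult ρ * (4 * Real.sin (liZeroAngle ρ.im / 2)) *
          |Real.sin (((n : ℝ) + 1 / 2) * liZeroAngle ρ.im)|
        ≤ LiLowZeroBudget.mult ρ * (2 / ρ.im) * 1 :=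
          mul_le_mul (mul_le_mul_of_nonneg_left ha1 hm0) hs (abs_nonneg _)
            (mul_nonneg hm0 (by positivity))
      _ = 2 * (LiLowZeroBudget.mult ρ / ρ.im) := by ring
  unfold lowSum
  calc |∑ ρ ∈ zerosBetween 0 Y, mult ρ * (4 * Real.sin (liZeroAngle ρ.im / 2)) *
          Real.sin (((n : ℝ) + 1 / 2) * liZeroAngle ρ.im)|
      ≤ ∑ ρ ∈ zerosBetween 0 Y, |mult ρ * (4 * Real.sin (liZeroAngle ρ.im / 2)) *
          Real.sin (((n : ℝ) + 1 / 2) * liZeroAngle ρ.im)| := Finset.abs_sum_le_sum_abs _ _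
    _ ≤ ∑ ρ ∈ zerosBetween 0 Y, 2 * (LiLowZeroBudget.mult ρ / ρ.im) := Finset.sum_le_sum hterm
    _ = 2 * ∑ ρ ∈ zerosBetween 0 Y, LiLowZeroBudget.mult ρ / ρ.im := by rw [Finset.mul_sum]
    _ ≤ 12 * Real.log ((⌈Y⌉₊ : ℝ) + 2) * (1 + Real.log ((⌈Y⌉₊ : ℝ) + 2)) := by linarith

/-! ## §2 The upper mirror of the tree's high-part chain -/

/-- **The model main term from above** (mirror of the tree's `model_main_lower`, same two-sided inputs):
for `n ≥ 1`, `1 ≤ Y ≤ n`, `T' ≥ max(Y, 16(n+3)³)`, `½∫_Y^{T'} w̃_n log(t/2π) ≤ π(liMainTerm(n+1) − liMainTerm n) + 2 + tailErr`. -/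
theorem model_main_upper {n : ℕ} (hn : 1 ≤ n) {Y T' : ℝ} (hY : 1 ≤ Y) (hYn : Y ≤ n)
    (hT : 16 * ((n : ℝ) + 3) ^ 3 ≤ T') (hYT : Y ≤ T') :
    ∫ t in Y..T', modelW n t * (Real.log (t / (2 * π)) / 2) ≤
      π * (liMainTerm (n + 1) - liMainTerm n) + 2
        + (2 * |cLog ((n : ℝ) + 1)| / (((n : ℝ) + 1) / Y) + 8 / Real.sqrt (((n : ℝ) + 1) / Y)
            + 2 / (((n : ℝ) + 1) / Y)
            + n * ((((n : ℝ) + 1) / Y - n / Y) *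
                (2 * (|cLog n| + Real.log (((n : ℝ) + 1) / Y)) / ((n : ℝ) / Y) ^ 2))) := by
  have hn1 : (1 : ℝ) ≤ n := by exact_mod_cast hn
  have hn0 : (0 : ℝ) < n := by linarith
  have hk1 : (0 : ℝ) < (n : ℝ) + 1 := by linarith
  have hY0 : 0 < Y := by linarith
  have hT0 : 0 < T' := by linarith
  -- sizes
  have hε₀ : 0 < (n : ℝ) / T' := div_pos hn0 hT0
  have hε₁ : 0 < ((n : ℝ) + 1) / T' := div_pos hk1 hT0
  have hU₀ : 1 ≤ (n : ℝ) / Y := by rw [le_div_iff₀ hY0]; linarith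
  have hU₀₁ : (n : ℝ) / Y ≤ ((n : ℝ) + 1) / Y := div_le_div_of_nonneg_right (by linarith) hY0.le
  have hU₁ : 1 ≤ ((n : ℝ) + 1) / Y := hU₀.trans hU₀₁
  have hU₀pos : 0 < (n : ℝ) / Y := by linarith
  have hU₁pos : 0 < ((n : ℝ) + 1) / Y := by linarith
  have hεU₀ : (n : ℝ) / T' ≤ (n : ℝ) / Y := div_le_div_of_nonneg_left hn0.le hY0 hYT
  have hεU₁ : ((n : ℝ) + 1) / T' ≤ ((n : ℝ) + 1) / Y := div_le_div_of_nonneg_left hk1.le hY0 hYT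
  rw [integral_modelW_log_eq hn hY0 hYT, integral_gK_split ((n : ℝ) + 1) hε₁.le hεU₁,
    integral_gK_split (n : ℝ) hε₀.le hεU₀]
  -- full terms
  have hF1 : ((n : ℝ) + 1) * ∫ u in Ioi 0, gK ((n : ℝ) + 1) u = π * liMainTerm (n + 1) := by
    have h := mul_integral_gK_Ioi (k := n + 1) (by omega)
    push_cast at h
    exact h
  have hF0 : (n : ℝ) * ∫ u in Ioi 0, gK n u = π * liMainTerm n := mul_integral_gK_Ioi hn
  -- heads
  have hT1 : 16 * (((n : ℝ) + 1) + 2) ^ 3 ≤ T' := by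
    have : ((n : ℝ) + 1) + 2 = (n : ℝ) + 3 := by ring
    rw [this]; exact hT
  have hT0' : 16 * ((n : ℝ) + 2) ^ 3 ≤ T' := by nlinarith [sq_nonneg ((n : ℝ) + 2)]
  have hH1 := head_small (k := (n : ℝ) + 1) (by linarith) hT1
  have hH0 := head_small (k := (n : ℝ)) hn1 hT0'
  have hH1' := abs_le.1 ((abs_mul _ _).trans_le (by rwa [abs_of_pos hk1]) :
    |((n : ℝ) + 1) * ∫ u in (0 : ℝ)..((n : ℝ) + 1) / T', gK ((n : ℝ) + 1) u| ≤ 1)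
  have hH0' := abs_le.1 ((abs_mul _ _).trans_le (by rwa [abs_of_pos hn0]) :
    |(n : ℝ) * ∫ u in (0 : ℝ)..(n : ℝ) / T', gK n u| ≤ 1)
  -- tails
  have hTl1 := abs_le.1 (abs_tail_le' ((n : ℝ) + 1) hU₁)
  have hdiff := tail_sub_tail (n : ℝ) ((n : ℝ) + 1) hU₁pos
  have hI := integral_one_sub_cos_tail_bounds hU₁pos
  have hc01 : 0 ≤ cLog ((n : ℝ) + 1) - cLog n ∧ cLog ((n : ℝ) + 1) - cLog n ≤ 1 / n := by
    have e : cLog ((n : ℝ) + 1) - cLog n = Real.log (((n : ℝ) + 1) / n) := by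
      unfold cLog
      rw [Real.log_div hk1.ne' (by positivity), Real.log_div hn0.ne' (by positivity),
        Real.log_div hk1.ne' hn0.ne']
      ring
    rw [e]
    constructor
    · exact Real.log_nonneg (by rw [le_div_iff₀ hn0]; linarith)
    · have h := Real.log_le_sub_one_of_pos (x := ((n : ℝ) + 1) / n) (by positivity)
      have e2 : ((n : ℝ) + 1) / n - 1 = 1 / n := by
        field_simp
        ring
      linarith
  have hmid : 0 ≤ (n : ℝ) * ((cLog ((n : ℝ) + 1) - cLog n) * ∫ u in Ioi (((n : ℝ) + 1) / Y),
      (1 - Real.cos u) / u ^ 2) ∧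
      (n : ℝ) * ((cLog ((n : ℝ) + 1) - cLog n) * ∫ u in Ioi (((n : ℝ) + 1) / Y),
        (1 - Real.cos u) / u ^ 2) ≤ 2 / (((n : ℝ) + 1) / Y) := by
    constructor
    · exact mul_nonneg hn0.le (mul_nonneg hc01.1 hI.1)
    · calc (n : ℝ) * ((cLog ((n : ℝ) + 1) - cLog n) * ∫ u in Ioi (((n : ℝ) + 1) / Y),
            (1 - Real.cos u) / u ^ 2)
          ≤ (n : ℝ) * ((1 / n) * (2 / (((n : ℝ) + 1) / Y))) :=
            mul_le_mul_of_nonneg_left (mul_le_mul hc01.2 hI.2 hI.1 (by positivity)) hn0.le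
        _ = 2 / (((n : ℝ) + 1) / Y) := by field_simp
  have hdiff' : (n : ℝ) * (∫ u in Ioi (((n : ℝ) + 1) / Y), gK ((n : ℝ) + 1) u)
      - (n : ℝ) * (∫ u in Ioi (((n : ℝ) + 1) / Y), gK n u) =
      (n : ℝ) * ((cLog ((n : ℝ) + 1) - cLog n) * ∫ u in Ioi (((n : ℝ) + 1) / Y),
        (1 - Real.cos u) / u ^ 2) := by
    rw [← mul_sub, hdiff]
  have hsplit0 : (n : ℝ) * (∫ u in Ioi ((n : ℝ) / Y), gK n u) =
      (n : ℝ) * (∫ u in (n : ℝ) / Y..((n : ℝ) + 1) / Y, gK n u)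
        + (n : ℝ) * ∫ u in Ioi (((n : ℝ) + 1) / Y), gK n u := by
    have h := intervalIntegral.integral_Ioi_sub_Ioi
      ((integrableOn_gK (n : ℝ)).mono_set (Ioi_subset_Ioi hU₀pos.le)) hU₀₁
    rw [← mul_add]
    congr 1
    linarith
  have hloc := abs_le.1 ((abs_mul _ _).trans_le
    ((congrArg (· * _) (abs_of_pos hn0)).le.trans
      (mul_le_mul_of_nonneg_left (abs_integral_gK_local_le (n : ℝ) hU₀ hU₀₁) hn0.le)) :
    |(n : ℝ) * ∫ u in (n : ℝ) / Y..((n : ℝ) + 1) / Y, gK n u| ≤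
      n * ((((n : ℝ) + 1) / Y - n / Y) *
        (2 * (|cLog n| + Real.log (((n : ℝ) + 1) / Y)) / ((n : ℝ) / Y) ^ 2)))
  linarith [hF1, hF0, hH1'.1, hH1'.2, hH0'.1, hH0'.2, hTl1.1, hTl1.2, hmid.1, hmid.2, hdiff',
    hsplit0, hloc.1, hloc.2]

/-- `liMainTerm(n+1) − liMainTerm(n) ≤ ½ log n + C₁ + 1` (`log(n+1) ≤ log n + 1/n`). -/
theorem liMainTerm_succ_sub_le {n : ℕ} (hn : 1 ≤ n) :
    liMainTerm (n + 1) - liMainTerm n ≤ Real.log n / 2 + liC1 + 1 := by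
  have hn1 : (1 : ℝ) ≤ n := by exact_mod_cast hn
  have hn0 : (0 : ℝ) < n := by linarith
  have hlog : Real.log ((n : ℝ) + 1) ≤ Real.log n + 1 / n := by
    have h := Real.log_le_sub_one_of_pos (x := ((n : ℝ) + 1) / n) (by positivity)
    rw [Real.log_div (by linarith) hn0.ne'] at h
    have e : ((n : ℝ) + 1) / n - 1 = 1 / n := by
      field_simp
      ring
    linarith
  have hlog0 : 0 ≤ Real.log n := Real.log_nonneg hn1
  have h1 : ((n : ℝ) + 1) / 2 * Real.log ((n : ℝ) + 1) ≤ ((n : ℝ) + 1) / 2 * (Real.log n + 1 / n) :=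
    mul_le_mul_of_nonneg_left hlog (by positivity)
  have h2 : ((n : ℝ) + 1) / 2 * (1 / n) ≤ 1 := by
    rw [div_mul_div_comm, div_le_one (by positivity)]
    linarith
  have e1 : ((n : ℝ) + 1) / 2 * (Real.log n + 1 / n)
      = (n : ℝ) / 2 * Real.log n + Real.log n / 2 + ((n : ℝ) + 1) / 2 * (1 / n) := by ring
  unfold liMainTerm
  push_cast
  linarith [h1, h2, e1]

/-- `C₁ = (γ − 1 − log 2π)/2 ≤ −1/6` (`γ < 2/3`, `log 2π ≥ 0`). -/
theorem liC1_le : liC1 ≤ -(1 / 6 : ℝ) := by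
  have hγ := Real.eulerMascheroniConstant_lt_two_thirds
  obtain ⟨h1, -⟩ := Summit.RiemannHypothesis.RiemannHypothesis.Theorems.LiTheory.Budget.log_two_pi_crude
  unfold liC1
  linarith

set_option maxHeartbeats 400000 in
/-- **The window right-hand side from above (RH-free)** (mirror of the tree's `window_rhs_lower`): for `n ≥ 1`, `Y ≥ 30`,
`4Y(log(n+1)+2) ≤ n` and `T' ≥ max(Y, 16(n+3)³)`, `RHS(T') ≤ ½ log n + n(0.34 log Y + 3.5)/Y² + 8`. -/
theorem window_rhs_upper {n : ℕ} (hn : 1 ≤ n) {Y T' : ℝ} (hY : 30 ≤ Y)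
    (hYn : 4 * Y * (Real.log ((n : ℝ) + 1) + 2) ≤ n) (hT : 16 * ((n : ℝ) + 3) ^ 3 ≤ T')
    (hYT : Y ≤ T') :
    1 / Real.pi * (∫ t in Y..T', incrWeight n t * riemannSiegelThetaDeriv t)
        + zetaArgS T' * incrWeight n T' - zetaArgS Y * incrWeight n Y
        - ∫ t in Y..T', zetaArgS t * incrWeightDeriv n t ≤
      Real.log n / 2 + n * (0.34 * Real.log Y + 3.5) / Y ^ 2 + 8 := by
  have hπ := Real.pi_pos
  have hπ3 := Real.pi_gt_three
  have hn1 : (1 : ℝ) ≤ n := by exact_mod_cast hn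
  have hn0 : (0 : ℝ) ≤ n := by linarith
  have hY0 : 0 < Y := by linarith
  have hY1 : 1 ≤ Y := by linarith
  have hL0 : 0 < Real.log ((n : ℝ) + 1) := Real.log_pos (by linarith)
  have hYn' : Y ≤ n := by nlinarith
  have h2π : 2 * π ≤ Y := by linarith [Real.pi_lt_four]
  -- continuity / integrability of the three pieces
  have hne : ∀ t ∈ uIcc Y T', t ≠ 0 := fun t ht ↦ by
    rw [uIcc_of_le hYT] at ht; linarith [ht.1]
  have hw : ContinuousOn (incrWeight n) (uIcc Y T') := fun t ht ↦
    (hasDerivAt_incrWeight n (hne t ht)).continuousAt.continuousWithinAt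
  have hlogc : ContinuousOn (fun t : ℝ ↦ Real.log (t / (2 * π)) / 2) (uIcc Y T') := by
    refine continuousOn_of_forall_continuousAt fun t ht ↦ ?_
    have : t / (2 * π) ≠ 0 := by
      have : 0 < t := by rw [uIcc_of_le hYT] at ht; linarith [ht.1]
      positivity
    fun_prop (disch := assumption)
  have hmW : ContinuousOn (modelW n) (uIcc Y T') := by
    refine continuousOn_of_forall_continuousAt fun t ht ↦ ?_
    have := hne t ht
    unfold modelW
    fun_prop (disch := assumption)
  have hϑ : Continuous riemannSiegelThetaDeriv := continuous_riemannSiegelThetaDeriv_holds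
  have hA : IntervalIntegrable
      (fun t ↦ incrWeight n t * (riemannSiegelThetaDeriv t - Real.log (t / (2 * π)) / 2))
      volume Y T' := (hw.mul (hϑ.continuousOn.sub hlogc)).intervalIntegrable
  have hB : IntervalIntegrable
      (fun t ↦ (incrWeight n t - modelW n t) * (Real.log (t / (2 * π)) / 2)) volume Y T' :=
    ((hw.sub hmW).mul hlogc).intervalIntegrable
  have hC : IntervalIntegrable (fun t ↦ modelW n t * (Real.log (t / (2 * π)) / 2)) volume Y T' :=
    (hmW.mul hlogc).intervalIntegrable
  have hsplit : ∫ t in Y..T', incrWeight n t * riemannSiegelThetaDeriv t =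
      (∫ t in Y..T', incrWeight n t * (riemannSiegelThetaDeriv t - Real.log (t / (2 * π)) / 2))
      + (∫ t in Y..T', (incrWeight n t - modelW n t) * (Real.log (t / (2 * π)) / 2))
      + ∫ t in Y..T', modelW n t * (Real.log (t / (2 * π)) / 2) := by
    rw [← intervalIntegral.integral_add hA hB, ← intervalIntegral.integral_add (hA.add hB) hC]
    apply intervalIntegral.integral_congr
    intro t _
    ring
  -- the bounds
  have hθ := abs_le.1 (abs_integral_thetaErr_le n hY1 hYT)
  have hM := abs_le.1 (abs_integral_modelErr_le n h2π hYT)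
  have hmain := model_main_upper hn hY1 hYn' hT hYT
  have htail := tail_small hn hY1 hYn
  have hΔ := liMainTerm_succ_sub_le hn
  have hC1 := liC1_le
  have htop := abs_le.1 (abs_S_mul_incrWeight_le n (hY.trans hYT))
  have hbot := abs_le.1 (abs_S_mul_incrWeight_le n hY)
  have hS := abs_le.1 (abs_integral_S_mul_incrWeightDeriv_le n hY hYT)
  -- numeric simplifications
  have h4Y : 4 / Y ≤ 4 / 30 := div_le_div_of_nonneg_left (by norm_num) (by norm_num) hY
  have hlogY : Real.log Y ≤ Y := by linarith [Real.log_le_sub_one_of_pos hY0]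
  have hlogY0 : 0 ≤ Real.log Y := Real.log_nonneg hY1
  set M : ℝ := (2 * n + 1) * (2 * Real.log Y + 1) / (48 * Y ^ 2) with hMdef
  have hM0 : 0 ≤ M := by positivity
  have hMle : M / 3 ≤ n * (0.028 * Real.log Y + 0.014) / Y ^ 2 + 0.001 := by
    rw [hMdef]
    have hY2 : (0 : ℝ) < Y ^ 2 := by positivity
    have e1 : (2 * n + 1) * (2 * Real.log Y + 1) / (48 * Y ^ 2) / 3 =
        (n * ((4 * Real.log Y + 2) / 144) + (2 * Real.log Y + 1) / 144) / Y ^ 2 := by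
      field_simp
      ring
    rw [e1, div_add' _ _ _ hY2.ne', div_le_div_iff_of_pos_right hY2]
    have h3 : (2 * Real.log Y + 1) / 144 ≤ 0.001 * Y ^ 2 := by nlinarith
    have h4 : 0 ≤ (n : ℝ) * Real.log Y := mul_nonneg hn0 hlogY0
    linarith
  set A := ∫ t in Y..T', incrWeight n t * (riemannSiegelThetaDeriv t - Real.log (t / (2 * π)) / 2)
  set B := ∫ t in Y..T', (incrWeight n t - modelW n t) * (Real.log (t / (2 * π)) / 2)
  set C := ∫ t in Y..T', modelW n t * (Real.log (t / (2 * π)) / 2)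
  have hABC : 1 / π * (A + B + C) ≤
      (liMainTerm (n + 1) - liMainTerm n) + 1 / π * (4 / Y + M + 8) := by
    have h1 : A + B + C ≤ 4 / Y + M + (π * (liMainTerm (n + 1) - liMainTerm n) + 8) := by
      linarith [hθ.2, hM.2]
    have h2 : 1 / π * (4 / Y + M + (π * (liMainTerm (n + 1) - liMainTerm n) + 8)) =
        (liMainTerm (n + 1) - liMainTerm n) + 1 / π * (4 / Y + M + 8) := by
      field_simp
      ring
    have h3 := mul_le_mul_of_nonneg_left h1 (by positivity : (0 : ℝ) ≤ 1 / π)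
    linarith
  have hπinv : 1 / π * (4 / Y + M + 8) ≤ 1 / 3 * (4 / Y + M + 8) :=
    mul_le_mul_of_nonneg_right (one_div_le_one_div_of_le (by norm_num) hπ3.le) (by positivity)
  have hpos1 : 0 ≤ (n : ℝ) * Real.log Y / Y ^ 2 := by positivity
  have hpos2 : 0 ≤ (n : ℝ) / Y ^ 2 := by positivity
  have h5 : 1 / π * (A + B + C) ≤ liMainTerm (n + 1) - liMainTerm n + 1 / 3 * (4 / Y + M + 8) := by
    linarith [hABC, hπinv]
  have h6 : 1 / 3 * (4 / Y + M + 8) ≤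
      2.72 + (n * (0.028 * Real.log Y + 0.014) / Y ^ 2 + 0.001) := by
    linarith [h4Y, hMle]
  have h7 : n * (0.028 * Real.log Y + 0.014) / Y ^ 2 + n * (0.3083 * Real.log Y + 3.4) / Y ^ 2
      ≤ n * (0.34 * Real.log Y + 3.5) / Y ^ 2 := by
    have hY2 : (0 : ℝ) < Y ^ 2 := by positivity
    rw [← add_div, div_le_div_iff_of_pos_right hY2]
    nlinarith [mul_nonneg hn0 hlogY0]
  rw [hsplit]
  linarith [h5, h6, h7, hΔ, hC1, htop.1, htop.2, hbot.1, hbot.2, hS.1, hS.2]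

/-- **Upper-bound transfer** (mirror of the tree's `highPart_ge_of_eventually`). -/
theorem highPart_le_of_eventually (hRH : _root_.RiemannHypothesis) {n : ℕ} (hn : 1 ≤ n) {Y B : ℝ}
    (hY : 0 < Y)
    (hB : ∀ᶠ T' : ℝ in atTop,
      1 / Real.pi * (∫ t in Y..T', incrWeight n t * riemannSiegelThetaDeriv t)
        + zetaArgS T' * incrWeight n T' - zetaArgS Y * incrWeight n Y
        - ∫ t in Y..T', zetaArgS t * incrWeightDeriv n t ≤ B) :
    highPart n Y ≤ B :=
  le_of_tendsto (tendsto_windowRHS_highPart hRH hn hY) hB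

/-- **RH ⟹ pointwise UPPER bound for the high part** (mirror of the tree's `highPart_lower`): for `n ≥ 1`, `Y ≥ 30`,
`4Y(log(n+1) + 2) ≤ n`, `highPart n Y ≤ ½ log n + n(0.34 log Y + 3.5)/Y² + 8`. RH-CONSEQUENCE. -/
theorem highPart_upper (hRH : _root_.RiemannHypothesis) {n : ℕ} (hn : 1 ≤ n) {Y : ℝ} (hY : 30 ≤ Y)
    (hYn : 4 * Y * (Real.log ((n : ℝ) + 1) + 2) ≤ n) :
    highPart n Y ≤ Real.log n / 2 + n * (0.34 * Real.log Y + 3.5) / Y ^ 2 + 8 := by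
  refine highPart_le_of_eventually hRH hn (by linarith) ?_
  filter_upwards [eventually_ge_atTop (max Y (16 * ((n : ℝ) + 3) ^ 3))] with T' hT'
  exact window_rhs_upper hn hY hYn ((le_max_right _ _).trans hT') ((le_max_left _ _).trans hT')

end Summit.RiemannHypothesis.RiemannHypothesis.Theorems.Splittings.LiIncrEnvelope

end
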